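import Mathlib
import HarnessLib
import HarnessLib.Audit
import Summits.CriticalPhenomena.Statement

/-!
Route: PercHollowCells

DORMANT since 2026-08-29T05:47:12Z (reconciler: no traction for 5.1 d (last activity statement-closed at 2026-08-24T02:20:30Z); parked, not closed — `ledger route dormant route-CriticalPhenomena-PercHollowCells --off` to reactivate) — unstaffed, not closed; items shared with open routes are served there. `ledger route dormant <id> --off` reactivates.

# Route PercHollowCells — hollow cells — critical in-box shattering at rate L^(-7/8), pushed below
p_c by monotonicity, cannot house Le Cam's forced subcritical giant if nu <= 15/16

It suffices to show X = QF ∧ W (card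
CriticalPhenomena/PercolationContinuityZ3/hollow-cells-inbox-shattering, its Item 4 'RateUpgrade'
promoted to the spine). QF (QuantFreeBoxShattering, an estimate AT p_c inside FREE boxes):
E_{p_c}|C_{Λ_L}(0)| = Σ_{x∈Λ_L} P_{p_c}(0 ↔ x inside Λ_L) ≤ C·L^{17/8} for all L ≥ 1, Λ_L = [−L,L]³
centred at 0 — the free-box shattering folklore F(L) := E|C_{Λ_L}(0)|/|Λ_L| → 0 (Hutchcroft2022 p.5)
with rate L^{−7/8}. W (SubcritOneArmWindow, a purely SUBCRITICAL length statement, 'ν ≤ 15/16 in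
one-arm form'): P_{p_c−ε}(0 ↔ ∂Λ_{⌈ε^{−15/16}⌉}) → 0 as ε ↓ 0. Neither part mentions θ(p_c); QF
alone does not give continuity (a weaving jump world may be shattered inside free boxes), W alone
does not either (it concerns p < p_c only); together they squeeze out every jump world because a
jump θ* > 0 forces, by Le Cam, a cluster of volume ≥ cθ*ε^{−2} with probability ≥ θ*/4 at p_c − ε, W
confines it to Λ_n with n = ε^{−15/16}, monotonicity in p (used downward, on in-box events) prices
its expected in-box volume by the CRITICAL free-box quantity ≤ C n^{17/8} = C ε^{−255/128}, and
255/128 < 2. The qualitative folklore F1 (FreeBoxShattering) is filed as the rank-2 crux: it is the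
unproved statement every downstream item leans on and its status decides five cards of this sub.
Lean: `(∃ C : ℝ, ∀ L : ℕ, 1 ≤ L → ∑ x ∈ Literature.Probability.LatticeModels.box 3 L,
(Literature.Probability.Percolation.bondPercolation (Literature.Probability.LatticeModels.zdGraph 3)
(Literature.Probability.Percolation.criticalProbI 3)).real
(Literature.Probability.Percolation.openConnIn (↑(Literature.Probability.LatticeModels.box 3 L)) 0
x) ≤ C * (L : ℝ) ^ ((17 : ℝ) / 8)) ∧ (∀ η : ℝ, 0 < η → ∃ ε₀ : ℝ, 0 < ε₀ ∧ ∀ p : unitInterval,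
(Literature.Probability.Percolation.criticalProbI 3 : ℝ) - ε₀ < (p : ℝ) → (p : ℝ) <
Literature.Probability.Percolation.criticalProbI 3 →
(Literature.Probability.Percolation.bondPercolation (Literature.Probability.LatticeModels.zdGraph 3)
p).real (Literature.Probability.Percolation.siteToBoundary 3
⌈((Literature.Probability.Percolation.criticalProbI 3 : ℝ) - (p : ℝ)) ^ (-(15 : ℝ) / 16)⌉₊) ≤ η)`

## Assembly
Pure measure-theoretic glue over proved tree facts (planner Sketch.lean rc 0; `Assembly ↔` the
inlined form by `Iff.rfl`). Suppose θ* := θ(p_c(ℤ³)) > 0 (0 < p_c < 1: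
`Grimmett1999_criticalProb_pos_lt_one_holds`). LeCamSubcritGiant gives c > 0 with P_{p_c−ε}(|C(0)| ≥
s) ≥ θ*/4, s = ⌊cθ*ε^{−2}⌋. Apply W with η = θ*/8: for 0 < ε < ε₀, P_{p_c−ε}(0 ↔ ∂Λ_n) ≤ θ*/8 with n
= ⌈ε^{−15/16}⌉. On {|C(0)| ≥ s} minus {0 ↔ ∂Λ_n} the whole cluster C(0) is the in-box cluster
C_{Λ_n}(0) (any open path leaving Λ_n passes through the inner vertex boundary while still inside
Λ_n), so P_{p_c−ε}(|C_{Λ_n}(0)| ≥ s) ≥ θ*/8 and E_{p_c−ε}|C_{Λ_n}(0)| ≥ sθ*/8. Monotone transfer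
(in-box connection events are increasing and measurable; `real_mono_of_isUpperSet`; p_c − ε ≤ p_c):
E_{p_c−ε}|C_{Λ_n}(0)| = Σ_{x∈Λ_n} P_{p_c−ε}(0 ↔ x in Λ_n) ≤ Σ_{x∈Λ_n} P_{p_c}(0 ↔ x in Λ_n) ≤ C
n^{17/8} by QF. Hence (cθ*ε^{−2} − 1)θ*/8 ≤ C(ε^{−15/16} + 1)^{17/8} ≤ C′ε^{−255/128} for small ε,
impossible as ε → 0 because 255/128 < 2 (norm_num). Therefore θ(p_c) = 0, i.e.
PercolationContinuityZ3 (`percolationContinuityZ3_iff` / unfolding).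

Rationale: WHY THIS LINE. A jump θ(p_c) = θ* > 0 announces itself below p_c: the event {|C(0)| ≥ s} is decided
by revealing ≤ 6s edges, so by the relative-entropy / Le Cam bound for explorations (Newman1986;
AizenmanKestenNewmanCMP1987 p.523; DewanMuirhead2022 Prop. 2.10; in the tree, sorry-free:
`real_clusterSizeGe_le_of_kl` of HutchcroftVolumeTail.lean, Hutchcroft2022Triangle Thm 1.3)
P_{p_c−ε}(|C(0)| ≥ cθ*ε^{−2}) ≥ θ*/4. The card's twist is to price this forced subcritical giant
with a CRITICAL quantity through monotonicity used 'upside down': in-box connections {0 ↔ x inside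
Λ_n} are increasing events, so for every p ≤ p_c, E_p[|C(0)|; C(0) confined to Λ_n] ≤
E_p|C_{Λ_n}(0)| ≤ E_{p_c}|C_{Λ_n}(0)| = |Λ_n|·F(n) (confined clusters are hollow), where F is the
free-box average that Hutchcroft2022 p.5 calls 'a well-known (and not too difficult) folklore
theorem' (F → 0, no proof or reference in print; two refuter audits and cards
free-box-folklore-knife-edge / free-box-shattering-is-a-branch could not reconstruct one).
Quantified, the collision reads L(ε)^{3−κ} ≳ θ*³ε^{−2} for the θ*/8-confinement radius L(ε) at p_c −
ε, so a jump needs BOTH slow in-box shattering (κ small) AND fast divergence of the subcritical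
length (ν ≥ 2/(3−κ)); the route files the two negations with a consistent budget, κ = 7/8 and ν₀ =
15/16 ((15/16)(17/8) = 255/128 < 2), each strictly on the safe side of the numerics (2−η = 2.046, ν
= 0.876; arXiv:1302.0421). Imported areas: statistical decision theory (two-point testing lower
bounds / KL chain rule for adaptive explorations), finite-size scaling (ChayesEtAl1986: the window
exponent 2/d that the card shows is never saturated in a jump world), and as ENGINE CLASSES for the
two cruxes: Hutchcroft's hierarchical renormalisation, which proves exactly the in-box bound
|Λ_r|^{−1}Σ_{x∈Λ_r}P_{β_c}(0 ↔ x inside Λ_r) ≤ A r^{−d+α} for long-range percolation (Hutchcroft2022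
eq. (1.3), arXiv:2103.17013), and quantitative Grimmett–Marstrand (DuminilcopinKozmaTassion2020 Thm
2: ξ_p ≤ exp(C|p−p_c|^{−2}), the only upper bound on ξ in d = 3). What the line does that prior
routes do not: PercTwoPointDecay asks full-space decay Σ_{Λ_R}τ_{p_c} ≤ CR^{3−a}, which is the
conjunct in one line (τ ≥ θ²); here the critical estimate lives inside FREE boxes, where it is NOT
equivalent to the conjunct, and the missing strength is bought on the subcritical side;
PercDebrisSweep factorises Newman's criterion as γ₀ < 3 × Kesten–Zhang-at-p_c, this route as (in-box
η-type bound at p_c) × (ν bound below p_c) — honest bookkeeping: the budget ν₀(3−κ) < 2 is Fisher's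
γ = ν(2−η) < 2, i.e. Newman's γ < 2 split into two pieces neither of which implies or is implied by
γ₀ < 2 rigorously.

RANKED CRUXES. #2 FreeBoxShattering (crux) — F1, the free-box shattering folklore at p_c(ℤ³) (card
Item 1): F(L) := |Λ_L|^{−1} Σ_{x∈Λ_L} P_{p_c}(0 ↔ x inside Λ_L) = E_{p_c}|C_{Λ_L}(0)|/|Λ_L| → 0 as L
→ ∞, for the in-box cluster of the CENTRE of the free box Λ_L = [−L,L]³ (bond percolation, zdGraph
3). Printed as 'well-known (and not too difficult) folklore … in every d ≥ 2' (Hutchcroft2022 =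
arXiv:2202.07634 p.5) without proof or reference; implied by the conjunct (F ≤ Cesàro mean of
τ_{p_c} → θ(p_c)² by the BK sandwich), strictly weaker in principle (a shattered jump world
satisfies it); the corner-rooted version is immediate from Barsky–Grimmett–Newman orthant
finiteness. Deliverable: a located proof (→ Literature fact, then hypothesis `(h : F1)`) or a
Theorems-file proof, or the verdict 'only known via θ(p_c) = 0'. QuantFreeBoxShattering implies it;
HollowCellsWindow consumes it. [difficulty: L] (why it might fail: As a theorem NOW: visible proofs
stop at limsup F ≤ θ(p_c)² (BK sandwich) or miss by an exponent gap ≈ 0.05 (lowest point + BK + BGN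
needs x_s + x_b > 3/2, numerics 1.45); only corner/boundary roots are free (BGN). It may be provable
only through θ(p_c) = 0 itself.) [Hutchcroft2022, arXiv:2202.07634, BarskyGrimmettNewman1991,
Grimmett1999, DewanMuirhead2022]
#3 QuantFreeBoxShattering (crux) — QF, quantitative free-box shattering with rate κ = 7/8 (card Item
4 promoted): ∃ C, ∀ L ≥ 1, E_{p_c}|C_{Λ_L}(0)| = Σ_{x∈Λ_L} P_{p_c}(0 ↔ x inside Λ_L) ≤ C L^{17/8},
i.e. F(L) ≤ C′ L^{−7/8}. Numerically E_{p_c}|C_{Λ_L}(0)| ≍ L^{2−η} = L^{2.046} (y_h = d_f =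
2.52295(15), arXiv:1302.0421 p.8), margin 0.079 in the exponent; the long-range analogue
|Λ_r|^{−1}Σ_{x∈Λ_r} P_{β_c}(0 ↔ x inside Λ_r) ≤ A r^{−d+α} is a THEOREM (Hutchcroft2022 eq. (1.3),
by the hierarchical renormalisation of arXiv:2103.17013), and mean-field d > 6 has κ = d − 2.
Implied by PercTwoPointDecay.CritBallAverageDecay with a ≥ 7/8 (in-box ≤ full-space); NOT conversely
— the free boundary is what keeps QF weaker than the conjunct. [deps: FreeBoxShattering]
[difficulty: open-problem] (why it might fail: No upper bound on critical connectivities beyond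
BK/BGN exists for 3 ≤ d ≤ 6; only the free boundary separates QF from Σ_{Λ_L}τ_{p_c} ≤ CL^{17/8},
which already IS continuity (τ ≥ θ²); a weaving jump world could keep F(L) ≥ L^{−o(1)}; the exponent
7/8 leaves 0.079 to the numerics.) [Hutchcroft2022, arXiv:2103.17013, arXiv:1302.0421,
Hutchcroft2021, Grimmett1999]
#4 SubcritOneArmWindow (crux) — W, 'ν ≤ 15/16' in one-arm form (the subcritical partner): for every
η > 0 there is ε₀ > 0 such that for all p ∈ (p_c − ε₀, p_c), P_p(0 ↔ ∂Λ_n) ≤ η with n = ⌈(p_c −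
p)^{−15/16}⌉ — the subcritical one-arm probability at scale ε^{−15/16} vanishes as ε ↓ 0. True in
the real world for SUBCRITICAL reasons as soon as ξ(p_c − ε) ≤ ε^{−ν₁} eventually for some ν₁ <
15/16 (then P ≤ C n² e^{−n/ξ} → 0 by sharpness; numerics ν = 1/y_t = 0.8764(12), arXiv:1302.0421),
whereas today only ξ_p ≤ exp(C|p − p_c|^{−2}) is known (DuminilcopinKozmaTassion2020 Thm 2,
arXiv:1902.03207 p.4); the lower side ν ≥ 2/3 is the finite-size-scaling bound (ChayesEtAl1986). In
a jump world satisfying QF it is false — that is the assembly. [difficulty: open-problem] (why it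
might fail: Even a polynomial bound ξ_p ≤ |p − p_c|^{−A} is open on ℤ³ (best: exp(C ε^{−2}), DKT
2020 Thm 2); 15/16 sits only 0.06 above the numerical ν = 0.876, so a proof must be nearly sharp;
scales below ξ are critical-looking, so nothing softer than a true ν-bound can give it.)
[DuminilcopinKozmaTassion2020, arXiv:1902.03207, ChayesEtAl1986, arXiv:1302.0421, Hutchcroft2020]
#9 LeCamSubcritGiant (support) — LC, the Le Cam / relative-entropy volume floor below p_c (card
pillar; Newman's announcement): if θ* := θ(p_c) > 0 then there is c > 0 with P_p(|C(0)| ≥ ⌊c θ* (p_c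
− p)^{−2}⌋) ≥ θ*/4 for every p ∈ (0, p_c). Proof, from tree material only:
`real_clusterSizeGe_le_of_kl` (HutchcroftVolumeTail.lean) with (p, q) := (p, p_c), Δ = 6
(`degree_zdGraph_le`), kl(p‖p_c) ≤ (p_c − p)²/(p_c(1 − p_c)) (KL ≤ χ²; 0 < p_c < 1 by
`Grimmett1999_criticalProb_pos_lt_one_holds`), the crude bound Σ_{j≤s} P_p(|C| ≥ j) ≤ s, and {0 ↔ ∞}
⊆ {|C(0)| ≥ s}; c = p_c(1 − p_c)/96 works. [difficulty: provable-now] [Hutchcroft2022Triangle,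
DewanMuirhead2022, Newman1986, AizenmanKestenNewmanCMP1987]
#9 HollowCellsWindow (support) — The card's theorem (H1) 'window beats CCFS', with F1 as explicit
hypothesis: FreeBoxShattering → θ* := θ(p_c) > 0 → for every c > 0 there is ε₀ > 0 such that for all
p ∈ (p_c − ε₀, p_c), P_p(0 ↔ ∂Λ_{⌈c (p_c − p)^{−2/3}⌉}) > θ*/8 — in any jump world the
θ*/8-confinement radius below p_c exceeds every multiple of the Chayes–Chayes–Fisher–Spencer scale
ε^{−2/3} (cells are hollow: forced volume ≥ cθ*ε^{−2}, but E_p[|C(0)|; C(0) ⊆ Λ_{n−1}] ≤ |Λ_n| F(n)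
= o(n³)). Proof = LeCamSubcritGiant + confinement lemma ({|C(0)| ≥ s} minus {0 ↔ ∂Λ_n} ⊆
{|C_{Λ_n}(0)| ≥ s}: an open path leaving Λ_n meets the inner boundary inside Λ_n) + monotone
transfer E_p|C_{Λ_n}(0)| = Σ_x P_p(0 ↔ x in Λ_n) ≤ Σ_x P_{p_c}(0 ↔ x in Λ_n)
(`real_mono_of_isUpperSet`, SharpnessDCTProofs.lean) + F1 by contradiction along p_k ↑ p_c. About
250 Lean lines; the same glue proves the Assembly with F1 replaced by QF and c ε^{−2/3} by
ε^{−15/16}. [difficulty: provable-now] [ChayesEtAl1986, Hutchcroft2022, Hutchcroft2022Triangle,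
Newman1986]

TWO-LAYER PLAN. Foreseen glued splits (none filed now; k ≤ 3, depth 1). FreeBoxShattering ⇐
BoundaryLayerNull (roots within fixed depth of ∂Λ_L contribute o(L³): BGN half-space finiteness,
provable now) → InteriorThinness (E|C_{Λ_L}(x)| = o(L³) uniformly over interior roots: the real
content) → FreeBoxShattering. QuantFreeBoxShattering ⇐ InBoxTwoPointDecay (P_{p_c}(0 ↔ x inside Λ_L)
≤ C|x|^{−(1+7/8)} for x ∈ Λ_L, an Hutchcroft-type restricted two-point bound) → summation → QF; or
QF ⇐ QF(κ_small) → RateBootstrap(κ → 7/8). SubcritOneArmWindow ⇐ XiPolynomial (ξ_p ≤ C(p_c −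
p)^{−ν₁}, some ν₁ < 15/16, DKT's definition ξ_p = lim −n/log P_p(0 ↔ ∂Λ_n)) → SharpnessConversion
(P_p(0 ↔ ∂Λ_n) ≤ e^{−n/ξ_p} by supermultiplicativity, provable now) → W. If QF lands with a better
κ, W may be RESTATED with any ν₀ < 2/(3 − κ) (e.g. κ = 0.95 admits ν₀ < 0.9756).

KILL CRITERIA. (i) W refuted — a rigorous limsup_{ε→0} P_{p_c−ε}(0 ↔ ∂Λ_{ε^{−15/16}}) > 0, i.e. ν ≥
15/16 on ℤ³ — contradicts all numerics (ν = 0.876) but closes the route as filed: `close --reason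
refuted:SubcritOneArmWindow` unless QF has meanwhile landed with κ > 3 − 2/ν_refuted, in which case
restate W with an admissible ν₀ (pivot, same decl name policy permitting). (ii) QF refuted at p_c
(F(L) ≥ L^{−7/8+o(1)} infinitely often) closes the route `refuted:QuantFreeBoxShattering`; note ¬QF
is numerically excluded in the real world (it says η_box ≤ −1/8), so a rigorous ¬QF would itself be
sensational — more likely is the soft verdict 'QF is as hard as the conjunct', which is a dormancy
signal, not a kill. (iii) F1 shown to be provable ONLY via θ(p_c) = 0 does not refute anything but
downgrades HollowCellsWindow to a curiosity and tells the tenure planner to expect no cheap progress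
on r2/r3. (iv) Mooted (close superseded) if PercTwoPointDecay's CritBallAverageDecay, Newman's γ < 2
crux (card newman-sqrt-chi-integrability) or any other route closes the conjunct. (v) The exponent
budget itself cannot fail (255/128 < 2 is arithmetic); what can fail is TRUTH of the pair: Monte
Carlo giving 2 − η_box > 2.125 or ν > 0.9375 would mean the cruxes are false as filed — restate with
the measured margins or close.

NOT DECOMPOSED YET. Deliberately not items (provers attach them with `--supports`): the confinement
lemma ({|C(0)| ≥ s} minus siteToBoundary 3 n ⊆ {|C_{Λ_n}(0)| ≥ s}); the monotone-transfer identity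
E_p|C_{Λ_n}(0)| = Σ_x P_p(openConnIn Λ_n 0 x) and its monotonicity in p; KL(Ber p ‖ Ber q) ≤ (p −
q)²/(q(1 − q)); measurability of in-box events. Not decomposed: the engines for QF (restricted
two-point bounds, hierarchical/coarse-grained renormalisation inside a free box) and for W
(quantitative Grimmett–Marstrand beyond DKT, or any polynomial ξ bound) — layer-2 children once
someone has a foothold; the qualitative knife-edge partner of F1 ('∀η ∃c: P_{p_c−ε}(0 ↔
∂Λ_{cε^{−2/3}}) ≤ η eventually', equivalent to the conjunct given F1) is NOT filed; the card's audit
consequences (H2) hollowness at the cell scale, (H3) vacuity of announced-jump-dense-foam's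
ScaleComparability given F1, (H4) density caveats for GL-type gluing — evidence notes for those
cards, not statements here; CCFS (ν ≥ 2/3) itself is context, not an input.

CHEAPEST FALSIFIER. Two lookups and one cheap computation. (a) LOOKUP (an hour): locate the folklore
proof of F1 — Duminil-Copin's percolation lecture notes (2017/2018), Heydenreich–van der Hofstad
2017 ch. 11–13, Hutchcroft's own notes, or ask; if the only proof uses θ(p_c) = 0, r2 is
'conjunct-equivalent in practice' and r3 has no cheap rung (route stays alive but is dormant-grade).
(b) ARITHMETIC OF TRUTH (done here): the squeeze needs γ = ν(2 − η) < 2 in d = 3; numerics γ =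
1.79–1.82 ✓ (in d = 2, γ = 43/18 > 2 and the analogous crux pair is FALSE although θ(p_c) = 0 — the
mechanism is genuinely a 3 ≤ d ≤ 6 ∪ mean-field one). (c) KIT (≈ 1 cpu-day, Newman–Ziff union-find
at p_c = 0.2488126, L = 8…128; not run — hub compute-free this session): fit the growth exponent of
E_{p_c}|C_{Λ_L}(0)| (must be < 2.125; expected 2.046) and the one-arm collapse scale below p_c (ν
must be < 0.9375; expected 0.876). Either measured margin ≤ 0 retires the corresponding crux as
filed.

NUMBERS. d = 3 bond percolation, p_c = 0.2488126 (arXiv:1302.0421). y_t = 1/ν = 1.1410(15) ⇒ ν =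
0.8764(12); y_h = d_f = 2.52295(15) ⇒ 2 − η = 2d_f − 3 = 2.0459(3), η = −0.046 (arXiv:1302.0421
p.8). Route constants: κ = 7/8 (QF exponent 17/8 = 2.125, margin 0.079), ν₀ = 15/16 = 0.9375 (margin
0.061), budget ν₀(3 − κ) = 255/128 = 1.992 < 2; equivalently γ_budget < 2 vs γ = ν(2 − η) = 1.793.
Rigorous today: ν ≥ 2/3 (finite-size scaling length, ChayesEtAl1986), ξ_p ≤ exp(C|p − p_c|^{−2})
(DuminilcopinKozmaTassion2020 Thm 2), γ ≥ 1; jump ⇒ γ ≥ 2 (Newman1986); Le Cam floor s_ε = cθ*ε^{−2}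
at probability θ*/4 (constants 2, 8Δ of Hutchcroft2022Triangle Thm 1.3 as vendored). Mean-field
check: d > 6 has κ = d − 2, ν = 1/2, budget ν(d − κ) = 1 < 2 (consistent with continuity there).
Items at open: 6 (3 cruxes, 2 support, 1 assembly).

DEFINITION REQUESTS. None. All notions exist: Literature.Probability.Percolation.{bondPercolation,
openConnIn, siteToBoundary, openCluster, theta, criticalProbI},
Literature.Probability.LatticeModels.{zdGraph, box}. A named correlation length ξ_p for ℤ^d (DKT's
lim −n/log P_p(0 ↔ ∂Λ_n)) would make the layer-2 child XiPolynomial of W statable verbatim; not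
requested until W is split.

Novelty: Searches (2026-08-15): `lit read arxiv:2202.07634 --grep folklore` (p.5 L32, sentence read verbatim,
plus eq. (1.3) the LRP in-box bound); `lit read arxiv:1902.03207 --grep Theorem` (Thm 2 read, p.4);
`lit read arxiv:1302.0421 --grep y_t` (p.8 exponents); `lit search --hybrid "critical percolation
connection inside box free boundary average two-point tends to zero"` (8 book hits: Slade 2006,
Kesten 1982, Heydenreich–vdHofstad 2017, Grimmett 1999/2006 — no in-box shattering theorem); `lit
vsearch "upper bound on the correlation length of subcritical Bernoulli percolation … polynomial"`
(8 books, nothing beyond DKT); `lit search --source zbmath|crossref "percolation correlation length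
upper bound near critical" --year-from 2015` (3 + 8 rows: DKT2020, VandenbergVanengelenburg2022
doi:10.1214/21-aihp1153, Bates et al. EJP 2025 (2D FPP) — no polynomial ξ bound on ℤ³); `lit citing
arxiv:1902.03207` (13 citers screened: 2101.05801, 2002.02916, 2209.00999, 2008.11197, 2009.13337 …
none improves Thm 2 on ℤ^d); `lit frontier CriticalPhenomena --since 2021` (30 rows, none on θ(p_c)
in d = 3); OpenAlex/S2/arXiv APIs rate-limited (429) and `lit galaxy search … --star all|pdf`
saturated ('queued too long') at 11:40–12:10Z — recorded, not worked around; ledger: 9 route files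
of the sub read, `ledger negatives` (1 entry, SAW), sibling cards free-box-folklore-knife-edge,
free-box-shattering-is-a-branch, shattering-vs-uniqueness-race, box-hyperscaling-gluing,
nonproliferation-is-enough, newman  [refs: 10.1214/21-aihp1153, 10.1007/bf01021076, 2202.07634, 1902.03207, 1302.0421, arxiv:2202.07634, arxiv:1902.03207, arxiv:1302.0421, doi:10.1214/21-aihp1153, doi:10.1007/bf01021076, VandenbergVanengelenburg2022, Newman1986, Hutchcroft2022, DuminilcopinKozmaTassion2020, ChayesEtAl1986, DewanMuirhead2022]

Barriers (technique_class: monotone-transfer, in-box-shattering, le-cam, nu-window): - technique_class: monotone-transfer, in-box-shattering, le-cam, nu-window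
- Literature.Barriers.CriticalPhenomena.LongRangeDiscontinuity: the Le Cam floor and the downward
transfer are range-blind and hold verbatim in the Aizenman–Newman 1/r² jump world; the contradiction
needs QF, and in that world in-box (in-interval) critical connectivity is macroscopic (τ_{β_c} ≥ M²
carried inside intervals), so QF/F1 is exactly a finite-range, d ≥ 2 input — evaded through r3,
honestly not through the glue.
- Literature.Barriers.CriticalPhenomena.RandomClusterFirstOrder: LC uses independence (KL chain rule
over independently revealed edges, false for φ_{p,q}, q > 1) and QF is a free-boundary statement,
while the wired q > Q transition has in-box long-range order at p_c(q); the argument is q =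
1-specific twice and does not apply verbatim to random-cluster measures.
- Literature.Barriers.CriticalPhenomena.SpanningClustersAboveSix: not in class (no crossing/RSW
input); consistent above six dimensions (κ = d − 2, ν = 1/2, budget 1 < 2, continuity true) and,
notably, the analogous crux pair is FALSE in d = 2 (γ = 43/18 > 2) — the squeeze is a 3 ≤ d ≤ 6 ∪
mean-field mechanism, dimension entering only through the exponent budget.
- Literature.Barriers.CriticalPhenomena.GaussianDominationRoute: no reflection positivity or
infrared bound is used; QF asks decay only inside FREE boxes and is strictly weaker than the
full-space bound Σ_{Λ_R}τ ≤ CR^{3−a} of route PercTwoPointDecay that this barrier c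

History (route lifecycle, newest last):
- 2026-08-23T10:44:11Z · DORMANT — reconciler: no traction for 6.1 d (last activity item-evidence-added at 2026-08-17T08:36:23Z); parked, not closed — `ledger route dormant route-CriticalPhenomen (operator:999:1786222)
- 2026-08-23T14:54:42Z · REACTIVATED — reconciler: reactivated — activity item-proof-filed at 2026-08-23T13:48:39Z after parking at 2026-08-23T10:44:11Z (operator:999:1873976)
- 2026-08-29T05:47:12Z · DORMANT — reconciler: no traction for 5.1 d (last activity statement-closed at 2026-08-24T02:20:30Z); parked, not closed — `ledger route dormant route-CriticalPhenomena-P (operator:999:1163630)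

sub-problem: PercolationContinuityZ3 · status: dormant · opened planner-plancard-CriticalPhenomena-Percolatio-5eea7e11-0 2026-08-15T11:43:02Z · rev 2 · ledger route-CriticalPhenomena-PercHollowCells
GENERATED by the gate from the ledger (D-0016/17). Provers cite these decls: `theorem foo : Summit.CriticalPhenomena.PercolationContinuityZ3.Theses.PercHollowCells.<Decl> := …` in Summits/CriticalPhenomena/PercolationContinuityZ3/Theorems/<Name>.lean.
-/

namespace Summit.CriticalPhenomena.PercolationContinuityZ3.Theses.PercHollowCells

open scoped BigOperators Topology Manifold Classical MeasureTheory ProbabilityTheory Matrix InnerProductSpace ComplexConjugate ContinuousMap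
open Filter Set Function TopologicalSpace MeasureTheory

attribute [summit_statement] _root_.PercolationContinuityZ3

/-- item stmt-CriticalPhenomena-5837 · crux · rank 3 · open · by planner
why it might fail: Open: no upper bound on critical connectivities beyond BK/BGN in 3≤d≤6; unlike F1/W NOT implied by θ(p_c)=0 (needs the rate L^{-7/8}); only the long-range analogue is proved (arXiv:2202.07634 eq. (1.3)); margin 0.079 to numerics 2−η=2.046 (arXiv:1302.0421); a weaving jump world keeps F ≥ L^{-o(1)}
sources: Hutchcroft2022, arXiv:2202.07634, arXiv:2103.17013, arXiv:1302.0421, Hutchcroft2021, Grimmett1999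
[crux] QF, quantitative free-box shattering with rate κ = 7/8 (card Item 4 promoted): ∃ C, ∀ L ≥ 1,
E_{p_c}|C_{Λ_L}(0)| = Σ_{x∈Λ_L} P_{p_c}(0 ↔ x inside Λ_L) ≤ C L^{17/8}, i.e. F(L) ≤ C′ L^{−7/8}.
Numerically E_{p_c}|C_{Λ_L}(0)| ≍ L^{2−η} = L^{2.046} (y_h = d_f = 2.52295(15), arXiv:1302.0421
p.8), margin 0.079 in the exponent; the long-range analogue |Λ_r|^{−1}Σ_{x∈Λ_r} P_{β_c}(0 ↔ x inside
Λ_r) ≤ A r^{−d+α} is a THEOREM (Hutchcroft2022 eq. (1.3), by the hierarchical renormalisation of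
arXiv:2103.17013), and mean-field d > 6 has κ = d − 2. Implied by
PercTwoPointDecay.CritBallAverageDecay with a ≥ 7/8 (in-box ≤ full-space); NOT conversely — the free
boundary is what keeps QF weaker than the conjunct. [deps: FreeBoxShattering] [difficulty:
open-problem] -/
@[route_item "route-CriticalPhenomena-PercHollowCells"]
def QuantFreeBoxShattering : Prop :=
  ∃ C : ℝ, ∀ L : ℕ, 1 ≤ L → ∑ x ∈ Literature.Probability.LatticeModels.box 3 L, (Literature.Probability.Percolation.bondPercolation (Literature.Probability.LatticeModels.zdGraph 3) (Literature.Probability.Percolation.criticalProbI 3)).real (Literature.Probability.Percolation.openConnIn (↑(Literature.Probability.LatticeModels.box 3 L)) 0 x) ≤ C * (L : ℝ) ^ ((17 : ℝ) / 8)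

/-- item stmt-CriticalPhenomena-5838 · crux · rank 4 · closed · proved by Summit.CriticalPhenomena.PercolationContinuityZ3.Theorems.HollowCellsSubcritOneArmWindow.subcritOneArmWindow_proof @ bd5605cd7f5c (prover) · by planner
why it might fail: Implied by the conjunct (P_p(0↔∂Λ_{n(p)}) ≤ P_{p_c}(0↔∂Λ_{n(p)}) ↓ θ(p_c) as p↑p_c), so ¬W ⟹ θ(p_c)>0: unrefutable; kill criterion (i) 'ν ≥ 15/16' misreads it. A conjunct-free proof needs ξ_p ≤ (p_c−p)^{−ν₁}, ν₁<15/16, vs best known exp(C|p−p_c|^{−2}) (arXiv:1902.03207 Thm 2); 0.06 above ν=0.876.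
sources: DuminilcopinKozmaTassion2020, arXiv:1902.03207, ChayesEtAl1986, arXiv:1302.0421, Hutchcroft2020
[crux] W, 'ν ≤ 15/16' in one-arm form (the subcritical partner): for every η > 0 there is ε₀ > 0
such that for all p ∈ (p_c − ε₀, p_c), P_p(0 ↔ ∂Λ_n) ≤ η with n = ⌈(p_c − p)^{−15/16}⌉ — the
subcritical one-arm probability at scale ε^{−15/16} vanishes as ε ↓ 0. True in the real world for
SUBCRITICAL reasons as soon as ξ(p_c − ε) ≤ ε^{−ν₁} eventually for some ν₁ < 15/16 (then P ≤ C n²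
e^{−n/ξ} → 0 by sharpness; numerics ν = 1/y_t = 0.8764(12), arXiv:1302.0421), whereas today only ξ_p
≤ exp(C|p − p_c|^{−2}) is known (DuminilcopinKozmaTassion2020 Thm 2, arXiv:1902.03207 p.4); the
lower side ν ≥ 2/3 is the finite-size-scaling bound (ChayesEtAl1986). In a jump world satisfying QF
it is false — that is the assembly. [difficulty: open-problem] -/
@[route_item "route-CriticalPhenomena-PercHollowCells"]
def SubcritOneArmWindow : Prop :=
  ∀ η : ℝ, 0 < η → ∃ ε₀ : ℝ, 0 < ε₀ ∧ ∀ p : unitInterval, (Literature.Probability.Percolation.criticalProbI 3 : ℝ) - ε₀ < (p : ℝ) → (p : ℝ) < Literature.Probability.Percolation.criticalProbI 3 → (Literature.Probability.Percolation.bondPercolation (Literature.Probability.LatticeModels.zdGraph 3) p).real (Literature.Probability.Percolation.siteToBoundary 3 ⌈((Literature.Probability.Percolation.criticalProbI 3 : ℝ) - (p : ℝ)) ^ (-(15 : ℝ) / 16)⌉₊) ≤ η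

-- `SubcritOneArmWindow` holds: proved by `Summit.CriticalPhenomena.PercolationContinuityZ3.Theorems.HollowCellsSubcritOneArmWindow.subcritOneArmWindow_proof` @ bd5605cd7f5c (its module imports this route file, so no `_holds` link can be stated here).

/-- item stmt-CriticalPhenomena-5836 · banked · rank 2 · closed · proved by Summit.CriticalPhenomena.PercolationContinuityZ3.Theorems.HollowCellsFreeBoxShattering.freeBoxShattering_proof @ abcbfe837674 (prover) · by planner
why it might fail: Unrefutable short of θ(p_c)>0 (conjunct ⟹ F1: {0↔x in Λ_L} ⊆ one-arm to |x|∞, Cesàro). As an UNCONDITIONAL theorem the 'folklore' of arXiv:2202.07634 p.5 has no proof/reference in print: one-arm/BK give only limsup F ≤ θ(p_c)², BGN (Grimmett1999 Thm 7.35) frees only boundary roots; may need θ(p_c)=0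
sources: arXiv:2202.07634, Hutchcroft2022, BarskyGrimmettNewman1991, Grimmett1999, DewanMuirhead2022
[crux] F1, the free-box shattering folklore at p_c(ℤ³) (card Item 1): F(L) := |Λ_L|^{−1} Σ_{x∈Λ_L}
P_{p_c}(0 ↔ x inside Λ_L) = E_{p_c}|C_{Λ_L}(0)|/|Λ_L| → 0 as L → ∞, for the in-box cluster of the
CENTRE of the free box Λ_L = [−L,L]³ (bond percolation, zdGraph 3). Printed as 'well-known (and not
too difficult) folklore … in every d ≥ 2' (Hutchcroft2022 = arXiv:2202.07634 p.5) without proof or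
reference; implied by the conjunct (F ≤ Cesàro mean of τ_{p_c} → θ(p_c)² by the BK sandwich),
strictly weaker in principle (a shattered jump world satisfies it); the corner-rooted version is
immediate from Barsky–Grimmett–Newman orthant finiteness. Deliverable: a located proof (→ Literature
fact, then hypothesis `(h : F1)`) or a Theorems-file proof, or the verdict 'only known via θ(p_c) =
0'. QuantFreeBoxShattering implies it; HollowCellsWindow consumes it. [difficulty: L] -/
@[route_item "route-CriticalPhenomena-PercHollowCells"]
def FreeBoxShattering : Prop :=
  Filter.Tendsto (fun L : ℕ => (∑ x ∈ Literature.Probability.LatticeModels.box 3 L, (Literature.Probability.Percolation.bondPercolation (Literature.Probability.LatticeModels.zdGraph 3) (Literature.Probability.Percolation.criticalProbI 3)).real (Literature.Probability.Percolation.openConnIn (↑(Literature.Probability.LatticeModels.box 3 L)) 0 x)) / ((2 * (L : ℝ) + 1) ^ 3)) Filter.atTop (nhds 0)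

-- `FreeBoxShattering` holds: proved by `Summit.CriticalPhenomena.PercolationContinuityZ3.Theorems.HollowCellsFreeBoxShattering.freeBoxShattering_proof` @ abcbfe837674 (its module imports this route file, so no `_holds` link can be stated here).

/-- item stmt-CriticalPhenomena-5839 · support · rank 9 · closed · proved by Summit.CriticalPhenomena.PercolationContinuityZ3.Theorems.PercHollowCellsLeCamSubcritGiant.leCamSubcritGiant_proof @ 553e632dd2ac (prover) · by planner
sources: Hutchcroft2022Triangle, DewanMuirhead2022, Newman1986, AizenmanKestenNewmanCMP1987
[support] LC, the Le Cam / relative-entropy volume floor below p_c (card pillar; Newman's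
announcement): if θ* := θ(p_c) > 0 then there is c > 0 with P_p(|C(0)| ≥ ⌊c θ* (p_c − p)^{−2}⌋) ≥
θ*/4 for every p ∈ (0, p_c). Proof, from tree material only: `real_clusterSizeGe_le_of_kl`
(HutchcroftVolumeTail.lean) with (p, q) := (p, p_c), Δ = 6 (`degree_zdGraph_le`), kl(p‖p_c) ≤ (p_c −
p)²/(p_c(1 − p_c)) (KL ≤ χ²; 0 < p_c < 1 by `Grimmett1999_criticalProb_pos_lt_one_holds`), the crude
bound Σ_{j≤s} P_p(|C| ≥ j) ≤ s, and {0 ↔ ∞} ⊆ {|C(0)| ≥ s}; c = p_c(1 − p_c)/96 works. [difficulty: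
provable-now] -/
@[route_item "route-CriticalPhenomena-PercHollowCells"]
def LeCamSubcritGiant : Prop :=
  0 < Literature.Probability.Percolation.theta (Literature.Probability.LatticeModels.zdGraph 3) 0 (Literature.Probability.Percolation.criticalProbI 3) → ∃ c : ℝ, 0 < c ∧ ∀ p : unitInterval, 0 < (p : ℝ) → (p : ℝ) < Literature.Probability.Percolation.criticalProbI 3 → Literature.Probability.Percolation.theta (Literature.Probability.LatticeModels.zdGraph 3) 0 (Literature.Probability.Percolation.criticalProbI 3) / 4 ≤ (Literature.Probability.Percolation.bondPercolation (Literature.Probability.LatticeModels.zdGraph 3) p).real {ω | ((⌊c * Literature.Probability.Percolation.theta (Literature.Probability.LatticeModels.zdGraph 3) 0 (Literature.Probability.Percolation.criticalProbI 3) * ((Literature.Probability.Percolation.criticalProbI 3 : ℝ) - (p : ℝ)) ^ (-(2 : ℝ))⌋₊ : ℕ) : ℕ∞) ≤ (Literature.Probability.Percolation.openCluster ω 0).encard}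

-- `LeCamSubcritGiant` holds: proved by `Summit.CriticalPhenomena.PercolationContinuityZ3.Theorems.PercHollowCellsLeCamSubcritGiant.leCamSubcritGiant_proof` @ 553e632dd2ac (its module imports this route file, so no `_holds` link can be stated here).

/-- item stmt-CriticalPhenomena-5840 · support · rank 9 · closed · proved by Summit.CriticalPhenomena.PercolationContinuityZ3.Theorems.PercHollowCellsHollowCellsWindow.hollowCellsWindow_proof @ 5afe996cae31 (prover) · by planner
sources: ChayesEtAl1986, Hutchcroft2022, Hutchcroft2022Triangle, Newman1986
[support] The card's theorem (H1) 'window beats CCFS', with F1 as explicit hypothesis: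
FreeBoxShattering → θ* := θ(p_c) > 0 → for every c > 0 there is ε₀ > 0 such that for all p ∈ (p_c −
ε₀, p_c), P_p(0 ↔ ∂Λ_{⌈c (p_c − p)^{−2/3}⌉}) > θ*/8 — in any jump world the θ*/8-confinement radius
below p_c exceeds every multiple of the Chayes–Chayes–Fisher–Spencer scale ε^{−2/3} (cells are
hollow: forced volume ≥ cθ*ε^{−2}, but E_p[|C(0)|; C(0) ⊆ Λ_{n−1}] ≤ |Λ_n| F(n) = o(n³)). Proof =
LeCamSubcritGiant + confinement lemma ({|C(0)| ≥ s} minus {0 ↔ ∂Λ_n} ⊆ {|C_{Λ_n}(0)| ≥ s}: an open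
path leaving Λ_n meets the inner boundary inside Λ_n) + monotone transfer E_p|C_{Λ_n}(0)| = Σ_x
P_p(0 ↔ x in Λ_n) ≤ Σ_x P_{p_c}(0 ↔ x in Λ_n) (`real_mono_of_isUpperSet`, SharpnessDCTProofs.lean) +
F1 by contradiction along p_k ↑ p_c. About 250 Lean lines; the same glue proves the Assembly with F1
replaced by QF and c ε^{−2/3} by ε^{−15/16}. [difficulty: provable-now] -/
@[route_item "route-CriticalPhenomena-PercHollowCells"]
def HollowCellsWindow : Prop :=
  Filter.Tendsto (fun L : ℕ => (∑ x ∈ Literature.Probability.LatticeModels.box 3 L, (Literature.Probability.Percolation.bondPercolation (Literature.Probability.LatticeModels.zdGraph 3) (Literature.Probability.Percolation.criticalProbI 3)).real (Literature.Probability.Percolation.openConnIn (↑(Literature.Probability.LatticeModels.box 3 L)) 0 x)) / ((2 * (L : ℝ) + 1) ^ 3)) Filter.atTop (nhds 0) → 0 < Literature.Probability.Percolation.theta (Literature.Probability.LatticeModels.zdGraph 3) 0 (Literature.Probability.Percolation.criticalProbI 3) → ∀ c : ℝ, 0 < c → ∃ ε₀ : ℝ, 0 < ε₀ ∧ ∀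 p : unitInterval, (Literature.Probability.Percolation.criticalProbI 3 : ℝ) - ε₀ < (p : ℝ) → (p : ℝ) < Literature.Probability.Percolation.criticalProbI 3 → Literature.Probability.Percolation.theta (Literature.Probability.LatticeModels.zdGraph 3) 0 (Literature.Probability.Percolation.criticalProbI 3) / 8 < (Literature.Probability.Percolation.bondPercolation (Literature.Probability.LatticeModels.zdGraph 3) p).real (Literature.Probability.Percolation.siteToBoundary 3 ⌈c * ((Literature.Probability.Percolation.criticalProbI 3 : ℝ) - (p : ℝ)) ^ (-(2 : ℝ) / 3)⌉₊)

-- `HollowCellsWindow` holds: proved by `Summit.CriticalPhenomena.PercolationContinuityZ3.Theorems.PercHollowCellsHollowCellsWindow.hollowCellsWindow_proof` @ 5afe996cae31 (its module imports this route file, so no `_holds` link can be stated here).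

/-- item stmt-CriticalPhenomena-5841 · assembly · rank 1 · closed · proved by Summit.CriticalPhenomena.PercolationContinuityZ3.Theorems.PercHollowCellsAssembly.assembly_proof @ 5586a73d16c7 (prover) · by planner
sources: Newman1986, Hutchcroft2022Triangle, Grimmett1999
[assembly] QuantFreeBoxShattering → SubcritOneArmWindow → PercolationContinuityZ3 (θ(p_c(ℤ³)) = 0),
by the Le Cam floor, confinement, downward monotone transfer and the exponent budget (15/16)(17/8) =
255/128 < 2; provable now (~350 Lean lines incl. LeCamSubcritGiant). -/
@[route_item "route-CriticalPhenomena-PercHollowCells"]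
def Assembly : Prop :=
  (∃ C : ℝ, ∀ L : ℕ, 1 ≤ L → ∑ x ∈ Literature.Probability.LatticeModels.box 3 L, (Literature.Probability.Percolation.bondPercolation (Literature.Probability.LatticeModels.zdGraph 3) (Literature.Probability.Percolation.criticalProbI 3)).real (Literature.Probability.Percolation.openConnIn (↑(Literature.Probability.LatticeModels.box 3 L)) 0 x) ≤ C * (L : ℝ) ^ ((17 : ℝ) / 8)) → (∀ η : ℝ, 0 < η → ∃ ε₀ : ℝ, 0 < ε₀ ∧ ∀ p : unitInterval, (Literature.Probability.Percolation.criticalProbI 3 : ℝ) - ε₀ < (p : ℝ) → (p : ℝ) < Literature.Probability.Percolation.criticalProbI 3 → (Literature.Probability.Percolation.bondPercolation (Literature.Probability.LatticeModels.zdGraph 3) p).real (Literature.Probability.Percolation.siteToBoundary 3 ⌈((Literature.Probability.Percolation.criticalProbI 3 : ℝ) - (p : ℝ)) ^ (-(15 : ℝ) / 16)⌉₊) ≤ η) → PercolationContinuityZ3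

-- `Assembly` holds: proved by `Summit.CriticalPhenomena.PercolationContinuityZ3.Theorems.PercHollowCellsAssembly.assembly_proof` @ 5586a73d16c7 (its module imports this route file, so no `_holds` link can be stated here).

/-! D-0027 §2.1 — DECIDING THEOREM (planner-authored via `route open/edit --closes-file`; by planner-rbadge-CriticalPhenomena-PercHollowCel-c72136ac-g4-0 2026-08-15T16:09:06Z):
its hypotheses are this route's items and its conclusion the sub-problem Statement (glue_lint), and it elaborates with this file. -/

@[closes "route-CriticalPhenomena-PercHollowCells"] theorem closes : FreeBoxShattering → QuantFreeBoxShattering → SubcritOneArmWindow → LeCamSubcritGiant → HollowCellsWindow → Assembly → _root_.PercolationContinuityZ3 := fun _h_FreeBoxShattering h_QuantFreeBoxShattering h_SubcritOneArmWindow _h_LeCamSubcritGiant _h_HollowCellsWindow h_Assembly => h_Assembly h_QuantFreeBoxShattering h_SubcritOneArmWindow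

end Summit.CriticalPhenomena.PercolationContinuityZ3.Theses.PercHollowCells
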